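import Literature.MathematicalPhysics.QuantumLattice.HeisenbergOrderNeelAssembly
import HarnessLib

/-!
# Kennedy–Lieb–Shastry 1988: the infrared-bound criterion for Néel order with a FREE energy input

Topic `MathematicalPhysics/QuantumLattice`; sibling PROOF file of `HeisenbergOrderNeelAssembly.lean`
(`kls_heis_ineq4`, `heis_neelOrder_of_infraredBound`). No definition, no named fact, no statement
of the tree is introduced or changed.

Kennedy–Lieb–Shastry's contradiction argument (J. Stat. Phys. 53 (1988), p. 1022) consumes exactly
ONE model-specific number besides the `T = 0` infrared bound (A) and the lattice integral
`I(d) = lim R_L(d)`: an upper bound on the ground-state energy per site `-e₀`, i.e. a LOWER bound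
`s₀` on the nearest-neighbour correlation `-ε = -⟨S³_0 S³_δ⟩ = e₀/(3d)` ("Thus, (4) implies that
`e₀ ≤ 0.550`. However, taking the Néel state as a variational state shows that `-e₀` is less than
`-0.75`"). The tree's `heis_neelOrder_of_infraredBound` hard-wires the Néel-state value
`s₀ = S²/3` (threshold `2S/√6`). This file proves the same criterion with `s₀` free — any
variational state may be used — in finite volume and along the even tori, exactly as the tree's
version:

* `heis_neelOrder_of_infraredBound_energy` — `d ≥ 1`, spin `n/2`: if (A) holds on the even tori of
  side `2k ≥ 4`, if `s₀ > 0` bounds `-ε_{2k}` below for all large `k`, and if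
  `R_L(d) ≤ ρ < 2√(s₀/2) = √(2s₀)` for all large `L`, then for every `J > 0` the ground states of
  `J Σ 𝐒_x·𝐒_y` have Néel long-range order, `HasStaggeredEvenTorusLRO`; quantitatively the order
  parameter `3|Λ|⁻¹ĝ_Q` is eventually `≥ 3u₀(2u₀ - ρ)`, `u₀ = √(s₀/2)`;
* `heis_neelOrder_of_infraredBound_of_energy` — the tree's theorem recovered at `s₀ = S²/3`
  (`heisBondCorr_le`, the Néel bound (N)).

For `S = ½`, `d = 2` no admissible `s₀` makes the last hypothesis satisfiable (Anderson's bound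
`s₀ ≤ 1/8`, `√(2s₀) ≤ 1/2 < I(2) = 0.6468…`): that is the catalogued barrier
`Literature/Barriers/HubbardSuperconductivity/InfraredBoundNeelSpinHalf2D.lean`.

## References

* [KLS1988JSP] T. Kennedy, E. H. Lieb, B. S. Shastry, *Existence of Néel order in some spin-½
  Heisenberg antiferromagnets*, J. Stat. Phys. 53 (1988) 1019–1030 — p. 1022, eqs. (3)–(4) and the
  paragraph after (4).
* [DysonLiebSimon1978] F. J. Dyson, E. H. Lieb, B. Simon, J. Stat. Phys. 18 (1978) 335–383, §1,
  App. C (the variational Néel bound).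
-/

noncomputable section

open Filter Topology Matrix Finset
open Literature.MathematicalPhysics.QuantumLattice Literature.Probability.LatticeModels

namespace Literature.MathematicalPhysics.QuantumLattice

variable {d : ℕ}

/-- **Néel order from the infrared bound, a bound on the Riemann sums, and ANY energy input**
(Kennedy–Lieb–Shastry's contradiction argument with the variational number left free). For
`d ≥ 1`, spin `n/2`: if the `T = 0` infrared bound (A) holds on all even tori of side `2k ≥ 4`,
if `0 < s₀ ≤ -ε_{2k}` for all large `k` (`-ε = -⟨S³_0S³_δ⟩ = e₀/(3d)`: an upper bound on the
ground-state energy, e.g. from a trial state), and if `R_L(d) ≤ ρ < 2√(s₀/2)` for all large `L`,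
then for every `J > 0` the ground states of `J Σ 𝐒_x·𝐒_y` have Néel long-range order along even
tori: with `u = (-ε/2)^{1/2} ≥ u₀ = (s₀/2)^{1/2}` and (4) `2u² ≤ |Λ|⁻¹ĝ_Q + uρ`, the order
parameter is `3|Λ|⁻¹ĝ_Q ≥ 3(2u² - ρu) ≥ 3u₀(2u₀ - ρ) > 0`. [Kennedy–Lieb–Shastry 1988, p. 1022:
"(4) implies that `e₀ ≤ 0.550`. However, taking the Néel state as a variational state shows
that `-e₀` is less than `-0.75` … there must be Néel order"] [cite: KLS1988JSP, p. 1022] -/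
theorem heis_neelOrder_of_infraredBound_energy (hd : 1 ≤ d) {n : ℕ}
    (hA : ∀ k : ℕ, 2 ≤ k → ∀ q : TorusSite d (2 * k), q ≠ neelIndex (2 * k) →
      0 ≤ heisStructureFactor 0 (2 * k) n q ∧
        heisStructureFactor 0 (2 * k) n q ^ 2 *
            dispersion (latticeMomentum (2 * k) (q - neelIndex (2 * k))) ≤
          (-heisBondCorr (d := d) 0 (2 * k) n / 2) * dispersion (latticeMomentum (2 * k) q))
    {s₀ : ℝ} (hs₀ : 0 < s₀)
    (hε : ∀ᶠ k : ℕ in atTop, s₀ ≤ -heisBondCorr (d := d) 0 (2 * k) n)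
    (hρ : ∃ ρ : ℝ, ρ < 2 * Real.sqrt (s₀ / 2) ∧ ∀ᶠ L : ℕ in atTop, klsRiemannSum d L ≤ ρ)
    {J : ℝ} (hJ : 0 < J) :
    HasStaggeredEvenTorusLRO (fun L x y => groundStateSpinCorrTorus (d := d) L n J x y) := by
  rw [hasStaggeredEvenTorusLRO_iff_holds]
  obtain ⟨ρ, hρlt, hρev⟩ := hρ
  -- the constants
  set u₀ : ℝ := Real.sqrt (s₀ / 2) with hu₀_def
  have hu₀pos : 0 < u₀ := Real.sqrt_pos.2 (by positivity)
  have hu₀sq : u₀ ^ 2 = s₀ / 2 := Real.sq_sqrt (by positivity)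
  set c : ℝ := 3 * (u₀ * (2 * u₀ - ρ)) with hc_def
  have hc : 0 < c := by
    have : 0 < 2 * u₀ - ρ := by linarith
    positivity
  -- eventually `R_{2k+2} ≤ ρ` and `s₀ ≤ -ε_{2k+2}`
  have h2k : Tendsto (fun k : ℕ => 2 * k + 2) atTop atTop :=
    tendsto_atTop_atTop.2 fun b => ⟨b, fun k hk => by omega⟩
  have hRk : ∀ᶠ k : ℕ in atTop, klsRiemannSum d (2 * k + 2) ≤ ρ := h2k.eventually hρev
  have hk1 : Tendsto (fun k : ℕ => k + 1) atTop atTop := tendsto_add_atTop_nat 1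
  have hεk : ∀ᶠ k : ℕ in atTop, s₀ ≤ -heisBondCorr (d := d) 0 (2 * (k + 1)) n :=
    hk1.eventually hε
  -- eventually the order parameter is `≥ c`
  have hev : ∀ᶠ k : ℕ in atTop, c ≤
      (∑ x : TorusSite d (2 * k + 2), ∑ y : TorusSite d (2 * k + 2),
          (-1 : ℝ) ^ (∑ i, (x i).val) * (-1) ^ (∑ i, (y i).val) *
            groundStateSpinCorrTorus (2 * k + 2) n J x y) / ((2 * k + 2 : ℕ) : ℝ) ^ (2 * d) := by
    filter_upwards [hRk, hεk, eventually_ge_atTop 1] with k hRk' hεk' hk1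
    -- work on the torus of side `2K`, `K = k + 1 ≥ 2`
    haveI : NeZero (2 * (k + 1)) := ⟨by omega⟩
    have hK : 2 ≤ k + 1 := by omega
    have hsum := neelSum_eq (d := d) n (k + 1) hJ
    have h4 := kls_heis_ineq4 hd hK (hA (k + 1) hK)
    have hR0 : 0 ≤ klsRiemannSum d (2 * (k + 1)) := klsRiemannSum_nonneg _ _
    have hRρ : klsRiemannSum d (2 * (k + 1)) ≤ ρ := hRk'
    set s : ℝ := -heisBondCorr (d := d) 0 (2 * (k + 1)) n with hs_def
    set m : ℝ := heisStructureFactor 0 (2 * (k + 1)) n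
      (neelIndex (2 * (k + 1)) : TorusSite d (2 * (k + 1))) / ((2 * (k + 1) : ℕ) : ℝ) ^ d with hm_def
    set R : ℝ := klsRiemannSum d (2 * (k + 1)) with hR_def
    have hs0 : u₀ ^ 2 ≤ s / 2 := by rw [hu₀sq]; linarith
    set u : ℝ := Real.sqrt (s / 2) with hu_def
    have hu0 : 0 ≤ u := Real.sqrt_nonneg _
    have hsu : s = 2 * u ^ 2 := by
      rw [hu_def, Real.sq_sqrt (le_trans (sq_nonneg u₀) hs0)]
      ring
    have huu₀ : u₀ ≤ u := by
      rw [hu_def]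
      calc u₀ = Real.sqrt (u₀ ^ 2) := (Real.sqrt_sq hu₀pos.le).symm
        _ ≤ Real.sqrt (s / 2) := Real.sqrt_le_sqrt hs0
    -- (4): `2u² ≤ m + u R ≤ m + u ρ`
    have h4' : 2 * u ^ 2 ≤ m + u * ρ := by
      have : s ≤ m + u * R := h4
      nlinarith [mul_le_mul_of_nonneg_left hRρ hu0]
    -- monotonicity of `t ↦ 2t² - ρ t` on `t ≥ u₀ ≥ ρ/4`
    have hmono : u₀ * (2 * u₀ - ρ) ≤ 2 * u ^ 2 - u * ρ := by
      nlinarith [mul_nonneg (sub_nonneg.2 huu₀) (show 0 ≤ 2 * (u + u₀) - ρ by linarith)]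
    show c ≤ (∑ x : TorusSite d (2 * (k + 1)), ∑ y : TorusSite d (2 * (k + 1)),
          (-1 : ℝ) ^ (∑ i, (x i).val) * (-1) ^ (∑ i, (y i).val) *
            groundStateSpinCorrTorus (2 * (k + 1)) n J x y) / ((2 * (k + 1) : ℕ) : ℝ) ^ (2 * d)
    rw [hsum, hc_def]
    linarith
  refine hc.trans_le (le_liminf_of_le ?_ hev)
  exact isCoboundedUnder_ge_of_le atTop fun k => by
    haveI : NeZero (2 * k + 2) := ⟨by omega⟩
    exact neelSum_le (d := d) n (2 * k + 2) hJ

/-- The tree's `heis_neelOrder_of_infraredBound` is the case `s₀ = S²/3` (the Néel bound (N),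
`heisBondCorr_le`; `2√(S²/6) = 2S/√6 = n/√6`). [cite: KLS1988JSP, p. 1022] -/
theorem heis_neelOrder_of_infraredBound_of_energy (hd : 1 ≤ d) {n : ℕ} (hn : 1 ≤ n)
    (hA : ∀ k : ℕ, 2 ≤ k → ∀ q : TorusSite d (2 * k), q ≠ neelIndex (2 * k) →
      0 ≤ heisStructureFactor 0 (2 * k) n q ∧
        heisStructureFactor 0 (2 * k) n q ^ 2 *
            dispersion (latticeMomentum (2 * k) (q - neelIndex (2 * k))) ≤
          (-heisBondCorr (d := d) 0 (2 * k) n / 2) * dispersion (latticeMomentum (2 * k) q))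
    (hρ : ∃ ρ : ℝ, ρ < n / Real.sqrt 6 ∧ ∀ᶠ L : ℕ in atTop, klsRiemannSum d L ≤ ρ)
    {J : ℝ} (hJ : 0 < J) :
    HasStaggeredEvenTorusLRO (fun L x y => groundStateSpinCorrTorus (d := d) L n J x y) := by
  have hn1 : (1 : ℝ) ≤ n := by exact_mod_cast hn
  have hs₀ : (0 : ℝ) < ((n : ℝ) / 2) ^ 2 / 3 := by positivity
  refine heis_neelOrder_of_infraredBound_energy hd hA hs₀
    (eventually_atTop.2 ⟨2, fun k hk => by linarith [heisBondCorr_le hd n k hk]⟩) ?_ hJ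
  obtain ⟨ρ, hρlt, hρev⟩ := hρ
  refine ⟨ρ, ?_, hρev⟩
  have h : 2 * Real.sqrt (((n : ℝ) / 2) ^ 2 / 3 / 2) = n / Real.sqrt 6 := by
    rw [show ((n : ℝ) / 2) ^ 2 / 3 / 2 = ((n : ℝ) / 2 / Real.sqrt 6) ^ 2 from (neel_u0_sq n).symm,
      Real.sqrt_sq (by positivity)]
    ring
  rwa [h]

end Literature.MathematicalPhysics.QuantumLattice
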